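import Summits.Ventures.DiscreteObjects.UnitDistance.ReductionTowerZMod121Piece1
import Summits.Ventures.DiscreteObjects.UnitDistance.ReductionTowerZMod121Piece2
import Summits.Ventures.DiscreteObjects.UnitDistance.ReductionTowerZMod121Piece3
import Summits.Ventures.DiscreteObjects.UnitDistance.PadicHigherReduction
import HarnessLib

/-!
# `χ(G₂(11)) = χ(unitCircleGraph (ZMod 121)) = 5` in the kernel — Cioabă's equality at `(p, k) = (11, 2)` (cell `pub-namedobj`, (U), seat udg g25)

Framing (verbatim for the cell): lottery ticket; floor = certified bounds/negative ranges.

`G_k(p) = unitCircleGraph (ZMod (p^k))` bounds the chromatic number of every `p`-adic field plane (`PadicHigherReduction.lean`, Madore's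
principle at every order); S. M. Cioabă (PhD thesis, Queen's University 2005, Thm 4.3.7) proved `χ(G_{k+1}(p)) ≤ χ(G_k(p))` and wrote that he
believed equality.  `χ(G₁(11)) = 5` is `chromaticNumber_unitCircleGraph_zmod11` (udg g6).  HERE: `χ(G₂(11)) = 5` — the 494-vertex subgraph `W`
of `ReductionTowerZMod121Data.lean` has no proper 4-colouring (root run of the kernel search with the 9 refuted cut states of the piece files as
its `done` list; 2735 branch nodes in all), so `G₂(11)` is not 4-colourable (`not_colorable_four_zmod121`), while
`ZMod 121 → ZMod 11` gives `χ ≤ 5`.  (`W` was found by iterated DRAT-core extraction from the 14,641-vertex graph — CaDiCaL 3.0.1 + drat-trim,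
hub-local; a vertex-deletion-minimal, hence 5-vertex-critical, non-4-colourable subgraph of `G₂(11)` with 303 vertices and 1,579 edges was also
found, but its kernel search tree is ≈ 30× larger, so the redundant 494-vertex `W` is the kernel witness.)  CONSEQUENCE for the cell's ℚ₁₁ line: the order-2 reduction does not lower the bound `χ(K²) ≤ 5` for any
`K ⊂ ℚ₁₁`; a 4-colouring of some `G_k(11)`, `k ≥ 3`, remains the only way the 11-adic tower could give `4` (`G₃(11)` has 1,771,561 vertices; udg g19:
every loop-free translation quotient of it other than itself needs 5 colours).  In print: Cioabă's inequality and belief; the value at `(11, 2)` was the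
cell's SAT computation (udg g3) and is now a kernel theorem — PROVISIONAL wording 'ours, by computation' for the value, the principle is Madore's/Cioabă's.
-/

namespace Summit.Ventures.DiscreteObjects.UnitDistance

open SimpleGraph KBits

/-- The root run: propagate the initial forced colours, then search down to the 9 refuted cut states. -/
def z121run : Bool :=
  match propagate z121nb 200 (z121C0, z121C1, z121C2, z121C3, 2 ^ 494 - 1) with
  | none => true
  | some st => search z121nb 494 200 [z121Q1, z121Q2, z121Q3, z121Q4, z121Q5, z121Q6, z121Q7, z121Q8, z121Q9] 494 st

set_option maxHeartbeats 400000000 in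
set_option maxRecDepth 200000 in
/-- KERNEL FACT: the root run closes (every branch dies or reaches one of the refuted cut states). -/
theorem z121run_eq : z121run = true := by
  decide +kernel

set_option exponentiation.threshold 2048 in
/-- `G₂(11) = unitCircleGraph (ZMod 121)` is not 4-colourable (kernel): its subgraph `W` is not. -/
theorem not_colorable_four_zmod121 : ¬ (unitCircleGraph (ZMod 121)).Colorable 4 := by
  rintro ⟨C⟩
  have h0s : C (z121emb 0) ≠ C (z121emb 1) := C.valid (by decide)
  have h0w : C (z121emb 0) ≠ C (z121emb 3) := C.valid (by decide)
  obtain ⟨σ, hσ0, hσs, hσw⟩ : ∃ σ : Equiv.Perm (Fin 4), σ (C (z121emb 0)) = 0 ∧ σ (C (z121emb 1)) = 1 ∧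
      (σ (C (z121emb 3)) = 1 ∨ σ (C (z121emb 3)) = 2) := by
    by_cases hsw : C (z121emb 1) = C (z121emb 3)
    · obtain ⟨σ, h0, h1⟩ := exists_perm_fin4 _ _ h0s
      exact ⟨σ, h0, h1, Or.inl (by rw [← hsw, h1])⟩
    · obtain ⟨σ, h0, h1, h2⟩ := exists_perm_fin4_three _ _ _ h0s h0w hsw
      exact ⟨σ, h0, h1, Or.inr h2⟩
  let D := recolour C σ
  have hD : ∀ x, D x = σ (C x) := fun x => rfl
  let col : ℕ → ℕ := fun v => (D (z121emb v)).val
  have hP : Proper z121nb 494 col := by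
    intro v hv
    refine ⟨(D (z121emb v)).isLt, ?_⟩
    intro w hw hbit heq
    exact D.valid (z121_adj_of_testBit v w hv hw hbit) (Fin.ext heq).symm
  have hU : UBound 494 (z121C0, z121C1, z121C2, z121C3, 2 ^ 494 - 1) := by
    intro v hv
    change Nat.testBit (2 ^ 494 - 1) v = true at hv
    rw [Nat.testBit_two_pow_sub_one] at hv
    exact of_decide_eq_true hv
  have hC : Cons 494 col (z121C0, z121C1, z121C2, z121C3, 2 ^ 494 - 1) := by
    intro w hw _
    show Nat.testBit (getC z121C0 z121C1 z121C2 z121C3 (col w)) w = true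
    rw [z121_initBits w hw (col w) (hP w hw).1]
    simp only [Bool.and_eq_true, decide_eq_true_eq]
    refine ⟨⟨fun h => ?_, fun h => ?_⟩, fun h => ?_⟩
    · subst h; show (σ (C (z121emb 0))).val = 0; rw [hσ0]; rfl
    · subst h; show (σ (C (z121emb 1))).val = 1; rw [hσs]; rfl
    · subst h; show (σ (C (z121emb 3))).val = 1 ∨ (σ (C (z121emb 3))).val = 2
      rcases hσw with h | h <;> rw [h]
      · exact Or.inl rfl
      · exact Or.inr rfl
  have hdone : ∀ d ∈ [z121Q1, z121Q2, z121Q3, z121Q4, z121Q5, z121Q6, z121Q7, z121Q8, z121Q9], UBound 494 d → Cons 494 col d → False := by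
    intro d hd
    simp only [List.mem_cons, List.not_mem_nil, or_false] at hd
    rcases hd with rfl | rfl | rfl | rfl | rfl | rfl | rfl | rfl | rfl
    · exact z121_piece1 hP
    · exact z121_piece2 hP
    · exact z121_piece3 hP
    · exact z121_piece4 hP
    · exact z121_piece5 hP
    · exact z121_piece6 hP
    · exact z121_piece7 hP
    · exact z121_piece8 hP
    · exact z121_piece9 hP
  have hrun := z121run_eq
  unfold z121run at hrun
  split at hrun
  · rename_i hnone
    exact (propagate_sound hP 200 _ hU hC).1 hnone
  · rename_i st hst
    obtain ⟨hU', hC'⟩ := (propagate_sound hP 200 _ hU hC).2 st hst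
    exact search_sound hP hdone 494 st hrun hU' hC'

/-- `G₂(11)` is 5-colourable: reduce `ZMod 121 → ZMod 11` and use the kernel 5-colouring of `UD(𝔽₁₁²)`. -/
theorem colorable_five_zmod121 : (unitCircleGraph (ZMod 121)).Colorable 5 :=
  unitCircleGraph_colorable_of_ringHom (ZMod.castHom (show 11 ∣ 121 by norm_num) (ZMod 11)) unitCircleGraph_zmod11_colorable_five

/-- CIOABĂ'S EQUALITY AT `(11, 2)`, KERNEL: `χ(unitCircleGraph (ZMod 121)) = 5` (`= χ(unitCircleGraph (ZMod 11))`). -/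
theorem chromaticNumber_unitCircleGraph_zmod121 : (unitCircleGraph (ZMod 121)).chromaticNumber = 5 := by
  apply le_antisymm colorable_five_zmod121.chromaticNumber_le
  by_contra hlt
  have hlt' : (unitCircleGraph (ZMod 121)).chromaticNumber < (4 : ℕ∞) + 1 := lt_of_not_ge hlt
  have hle : (unitCircleGraph (ZMod 121)).chromaticNumber ≤ (4 : ℕ) := Order.le_of_lt_add_one hlt'
  exact not_colorable_four_zmod121 (chromaticNumber_le_iff_colorable.mp hle)

/-- The first two levels of the 11-adic reduction tower agree: `χ(G₂(11)) = χ(G₁(11))`. -/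
theorem chromaticNumber_zmod121_eq_zmod11 :
    (unitCircleGraph (ZMod 121)).chromaticNumber = (unitCircleGraph (ZMod 11)).chromaticNumber := by
  rw [chromaticNumber_unitCircleGraph_zmod121, chromaticNumber_unitCircleGraph_zmod11]

/-- Tower form (`k = 2` of `unitCircleGraph (ZMod (11 ^ k))`, cf. `chromaticNumber_unitCircleGraph_zmodPow11_bounds` in `PadicAllOrders.lean`):
`χ(G₂(11)) = 5`. -/
theorem chromaticNumber_unitCircleGraph_zmodPow11_two : (unitCircleGraph (ZMod (11 ^ 2))).chromaticNumber = 5 :=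
  chromaticNumber_unitCircleGraph_zmod121

end Summit.Ventures.DiscreteObjects.UnitDistance
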